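import Summits.BirchSwinnertonDyer.Rank1Residual.Supersingular.DescentLowerBoundLevel
import Summits.BirchSwinnertonDyer.Rank1Residual.SecondDescent.ShaDivisibleFromTwoNonempty
import Literature.GroupTheory.FiniteAbelian.AlternatingPairing
import Literature.NumberTheory.EllipticCurves.BSDShaProofs
import HarnessLib

/-!
# An ISOTROPIC Cassels–Tate pairing on `Ш[p]` forces `(#Ш[p])² ∣ #Ш` — the kernel road from a ZERO
# Gram matrix of the Cassels–Tate pairing on `Sel^(p) = Ш[p]` to `p^{2d} ∣ #Ш(E/ℚ)` and the typed
# LOWER half (cell `b2b-bsdres`, sub-cell additive-p1, gen 17; class-free TOOL theorems)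

HONEST FRAMING (cell `b2b-bsdres`, run/shared/lean/b2b/bsd-rank1-residual/, verbatim in every
file): the goal of the cell is to DELETE the COMBINATION-SHAPED residual classes of the
Birch–Swinnerton-Dyer formula for ALL analytic-rank `≤ 1` elliptic curves over `ℚ` — "full BSD
formula for every rank `≤ 1` curve in class `C`" assembled STRICTLY from published theorems — so
that the rank-`≤ 1` remainder becomes exactly the CONSTRUCTION-SHAPED classes, which are TYPED
(missing-input `Prop`s), NOT attempted. This is not "finishing BSD". Sub-cell additive-p1
(X3♯(M) / X4(M): additive, potentially MULTIPLICATIVE prime) is a research route; X3♯(M) and X4(M)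
stay CONSTRUCTION-SHAPED; nothing is booked by this file (the lane books, the referee signs).
THEOREMS ONLY (no definition, no named fact, no `sorry`); class-free and reduction-type-free.

## What this file does

The (M) residue map of gen 16 (`HOME/b2b-bsdres-additive-p1/census-g16/M-RESIDUE-book210.md`) has
ONE block with no kernel road: the rank-`0` cells with `ord_p #Ш(E)_an = 4` and
`dim_{𝔽_p} Sel^(p)(E/ℚ) = 2` EXACT (so `Ш(E)[p] = (ℤ/p)²`, consistent with the predicted
`Ш(E)[p^∞] = (ℤ/p²)²`). Their LOWER half needs `p³ ∣ #Ш(E)`, which a plain `p`-descent CANNOT see.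
What CAN see it is the Cassels–Tate pairing on `Sel^(p) = Ш[p]` (rank `0`, `E(ℚ)[p] = 0`): its Gram
matrix on an `𝔽_p`-basis is ZERO exactly when `Ш[p] ⊆ pШ` (Cassels 1998 §1: the kernel of `⟨·,·⟩`
on `S^(p)` is the image of `S^(p²)`). This file proves the kernel half of that sentence and its
consequence for `#Ш`, for ANY finite abelian group:

* §1 (pure algebra). For a finite abelian group `A` with a bi-additive pairing `B` that is
  alternating, non-degenerate, with `p`-torsion values embedding in `𝔽_p`, and ISOTROPIC on `A[p]`
  (`B(x, y) = 0` for all `x, y ∈ A[p]`): `A[p] ⊆ pA` (the tree's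
  `Literature.GroupTheory.FiniteAbelian.mem_range_nsmul_of_forall_torsionBy`: the orthogonal of `A[p]`
  is `pA`), hence **`(#A[p])² ∣ #A`** (`#A = #A[p] · #pA` and `A[p] ≤ pA`), i.e. `#A[p] = p^d ⇒
  p^{2d} ∣ #A`. Vanishing on a generating set of `A[p]` suffices (`forall_closure_apply_eq_zero`), in
  particular on two independent classes when `#A[p] = p²` (`isotropic_of_gram_zero_pair`) — the shape
  a CTP-on-`Sel^(p)` instrument prints. The `ℚ/ℤ`-valued form with "kernel = divisible elements"
  (the PRINTED Cassels–Tate properties, Silverman *AEC* X.4.14, the shape of the tree's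
  `WeierstrassCurve.exists_casselsTate_pairing`) is `pow_two_mul_dvd_natCard_of_isotropic_addCircle`.
* §2 (`Ш`-level, any number field): `#Ш(E/K)[p] = p^d` + an isotropic pairing with the printed
  Cassels–Tate properties on finite `Ш(E/K)` ⇒ `p^{2d} ∣ #Ш(E/K)`; and at rank `0` with
  `p ∤ #E(K)_tors` the descent count `#Ш[p] = #Sel^(p)` (Silverman X.4.2, tree
  `card_torsionBy_sha_eq_of_card_selmerGroup`).
* §2′ (over `ℚ`): `p^{2d} ∣ #Ш(E/ℚ)` from `#Sel^(p)(E/ℚ) = p^d` + the isotropic binder, and the typed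
  LOWER half `MissingLowerBoundAt W p` when `ord_p #Ш_an ≤ 2d` — with NO parity step and NO appeal to
  the named Cassels–Tate fact: the per-pair binder `hCT0` ("the Cassels–Tate pairing — a pairing with
  the printed properties — is zero on `Ш[p]`", the instrument's ZERO-type document) carries it.

Instruments this road serves (existing; none run here): the CTP-on-`Sel^(3)` route A `ctp-sel3` of
unit x10 with verifier route B `ctpB` of engines/eng-exactrec (ZERO-type documents), whose Gram
matrix is the Cassels–Tate pairing by Fisher–Newton 2014 Thm. 1.3 / Cassels 1998 §1. The class
consumers (X4(M) ∧ surj, rank `0`) are in the sibling `RankZeroShaEightyOneCertificate.lean`.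
Per pair; NOT a class theorem; labels unchanged (X4(M) CONSTRUCTION-SHAPED; N10 (M) NEEDS X_E1).

References: Cassels 1962 [Cassels1962ArithmeticIV]; Silverman *AEC* X.4.14, X.4.2 [SilvermanAEC2009];
Cassels 1998 §1 [Cassels1998]; Fisher–Newton 2014 Thm. 1.3 [FisherNewton2014]; Miller 2011 Def. 1.1
[Miller2011LMS].
-/

noncomputable section

open scoped Classical

open WeierstrassCurve Literature.NumberTheory.EllipticCurves
  Literature.NumberTheory.EllipticCurves.ModularForms
  Literature.NumberTheory.EllipticCurves.Rank1Residual
  Literature.NumberTheory.EllipticCurves.Rank1Residual.Typed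
  Literature.GroupTheory.FiniteAbelian

namespace Summit.BirchSwinnertonDyer.Rank1Residual.AdditivePotMult

/-! ### §1 Algebra: an isotropic `A[p]` lies in `pA`, so `(#A[p])² ∣ #A` -/

section Algebra

variable {A : Type*} [AddCommGroup A] {Q : Type*} [AddCommGroup Q]

/-- **`A[n] ≤ nA ⇒ (#A[n])² ∣ #A`** for a finite abelian group: `#A = #A[n] · #nA` (first
isomorphism theorem for multiplication by `n`) and `#A[n] ∣ #nA` (Lagrange). [folklore] -/
theorem sq_natCard_torsionBy_dvd_natCard_of_le_range [Finite A] (n : ℕ)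
    (h : AddSubgroup.torsionBy A (n : ℤ) ≤ (nsmulAddMonoidHom (α := A) n).range) :
    Nat.card (AddSubgroup.torsionBy A (n : ℤ)) ^ 2 ∣ Nat.card A := by
  set m : A →+ A := nsmulAddMonoidHom n with hm
  have h1 := AddSubgroup.card_eq_card_quotient_mul_card_addSubgroup m.ker
  rw [Nat.card_congr (QuotientAddGroup.quotientKerEquivRange m).toEquiv,
    ker_nsmulAddMonoidHom_eq n] at h1
  have h2 : Nat.card (AddSubgroup.torsionBy A (n : ℤ)) ∣ Nat.card m.range :=
    AddSubgroup.card_dvd_of_le h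
  rw [h1, pow_two]
  exact Nat.mul_dvd_mul h2 dvd_rfl

/-- **A bi-additive pairing vanishing on `S × S` vanishes on `⟨S⟩ × ⟨S⟩`** (for fixed `y` the set
`{x | B x y = 0}` is a subgroup, and so is `{y | B x y = 0}`). [folklore] -/
theorem forall_closure_apply_eq_zero (B : A →+ A →+ Q) (S : Set A)
    (hS : ∀ x ∈ S, ∀ y ∈ S, B x y = 0) :
    ∀ x ∈ AddSubgroup.closure S, ∀ y ∈ AddSubgroup.closure S, B x y = 0 := by
  intro x hx y hy
  have h1 : ∀ z ∈ S, B x z = 0 := fun z hz => by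
    have hle : AddSubgroup.closure S ≤ (B.flip z).ker :=
      (AddSubgroup.closure_le _).mpr fun w hw => by
        rw [SetLike.mem_coe, AddMonoidHom.mem_ker, AddMonoidHom.flip_apply]
        exact hS w hw z hz
    have := hle hx
    rwa [AddMonoidHom.mem_ker, AddMonoidHom.flip_apply] at this
  have h2 : AddSubgroup.closure S ≤ (B x).ker :=
    (AddSubgroup.closure_le _).mpr fun w hw => by
      rw [SetLike.mem_coe, AddMonoidHom.mem_ker]
      exact h1 w hw
  exact h2 hy

/-- **Two independent `p`-torsion classes span `A[p]` when `#A[p] = p²`**: `⟨c₁, c₂⟩ = A[p]`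
(`#⟨c₁, c₂⟩ = p²`, cc-eng-4's `SecondDescent.card_closure_pair_eq_sq'`, and `⟨c₁, c₂⟩ ≤ A[p]`).
[folklore] -/
theorem closure_pair_eq_torsionBy [Finite A] {p : ℕ} (hp : p.Prime)
    (hcard : Nat.card (AddSubgroup.torsionBy A (p : ℤ)) = p ^ 2) {c₁ c₂ : A}
    (h1 : p • c₁ = 0) (h2 : p • c₂ = 0) (hc₁ : c₁ ≠ 0) (hind : c₂ ∉ AddSubgroup.zmultiples c₁) :
    AddSubgroup.closure ({c₁, c₂} : Set A) = AddSubgroup.torsionBy A (p : ℤ) := by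
  have hle : AddSubgroup.closure ({c₁, c₂} : Set A) ≤ AddSubgroup.torsionBy A (p : ℤ) := by
    rw [AddSubgroup.closure_le]
    intro a ha
    rcases ha with rfl | rfl
    · exact AddSubgroup.torsionBy.nsmul_iff.mpr h1
    · exact AddSubgroup.torsionBy.nsmul_iff.mpr h2
  exact AddSubgroup.eq_of_le_of_card_ge hle
    (by rw [hcard, SecondDescent.card_closure_pair_eq_sq' hp h1 h2 hc₁ hind])

/-- **ZERO Gram matrix on a basis ⇒ isotropic `A[p]`.** If `#A[p] = p²`, `c₁ ≠ 0`, `c₂ ∉ ℤ∙c₁` are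
`p`-torsion and `B cᵢ cⱼ = 0` for all four pairs, then `B` vanishes on `A[p] × A[p]` — the shape
a CTP-on-`Sel^(p)` instrument prints for `dim Sel^(p) = 2` (Gram matrix `[0 0; 0 0]`).
[cite: FisherNewton2014, Thm. 1.3] [cite: Cassels1998, §1] -/
theorem isotropic_of_gram_zero_pair [Finite A] {p : ℕ} (hp : p.Prime) (B : A →+ A →+ Q)
    (hcard : Nat.card (AddSubgroup.torsionBy A (p : ℤ)) = p ^ 2) {c₁ c₂ : A}
    (h1 : p • c₁ = 0) (h2 : p • c₂ = 0) (hc₁ : c₁ ≠ 0) (hind : c₂ ∉ AddSubgroup.zmultiples c₁)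
    (h₁₁ : B c₁ c₁ = 0) (h₁₂ : B c₁ c₂ = 0) (h₂₁ : B c₂ c₁ = 0) (h₂₂ : B c₂ c₂ = 0) :
    ∀ x ∈ AddSubgroup.torsionBy A (p : ℤ), ∀ y ∈ AddSubgroup.torsionBy A (p : ℤ), B x y = 0 := by
  rw [← closure_pair_eq_torsionBy hp hcard h1 h2 hc₁ hind]
  refine forall_closure_apply_eq_zero B _ ?_
  intro x hx y hy
  rcases hx with rfl | rfl <;> rcases hy with rfl | rfl <;> assumption

variable (p : ℕ) [hp : Fact p.Prime]

/-- **Isotropic `A[p]` lies in `pA`.** For a finite abelian group with an alternating non-degenerate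
bi-additive pairing whose `p`-torsion values embed in `𝔽_p`, if `B` vanishes on `A[p] × A[p]` then
every `p`-torsion element is a `p`-th multiple (the orthogonal of `A[p]` is `pA`:
`Literature.GroupTheory.FiniteAbelian.mem_range_nsmul_of_forall_torsionBy`). [cite: Cassels1998, §1] -/
theorem torsionBy_le_range_nsmul_of_isotropic [Finite A] (B : A →+ A →+ Q)
    (halt : ∀ x, B x x = 0) (hnd : ∀ x, (∀ y, B x y = 0) → x = 0)
    (ι : AddSubgroup.torsionBy Q (p : ℤ) →+ ZMod p) (hι : Function.Injective ι)
    (hiso : ∀ x ∈ AddSubgroup.torsionBy A (p : ℤ), ∀ y ∈ AddSubgroup.torsionBy A (p : ℤ),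
      B x y = 0) :
    AddSubgroup.torsionBy A (p : ℤ) ≤ (nsmulAddMonoidHom (α := A) p).range := fun x hx =>
  mem_range_nsmul_of_forall_torsionBy p B halt hnd ι hι (hiso x hx)

/-- **Isotropic `A[p]` ⇒ `(#A[p])² ∣ #A`.** [cite: Cassels1998, §1] -/
theorem sq_natCard_torsionBy_dvd_natCard_of_isotropic [Finite A] (B : A →+ A →+ Q)
    (halt : ∀ x, B x x = 0) (hnd : ∀ x, (∀ y, B x y = 0) → x = 0)
    (ι : AddSubgroup.torsionBy Q (p : ℤ) →+ ZMod p) (hι : Function.Injective ι)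
    (hiso : ∀ x ∈ AddSubgroup.torsionBy A (p : ℤ), ∀ y ∈ AddSubgroup.torsionBy A (p : ℤ),
      B x y = 0) :
    Nat.card (AddSubgroup.torsionBy A (p : ℤ)) ^ 2 ∣ Nat.card A :=
  sq_natCard_torsionBy_dvd_natCard_of_le_range p
    (torsionBy_le_range_nsmul_of_isotropic p B halt hnd ι hι hiso)

/-- **Isotropic `A[p]` with `#A[p] = p^d` ⇒ `p^{2d} ∣ #A`** (so for `d = 2`: `p⁴ ∣ #A`, i.e.
`A[p^∞] ⊇ (ℤ/p²)²`-sized). [cite: Cassels1998, §1] -/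
theorem pow_two_mul_dvd_natCard_of_isotropic [Finite A] (B : A →+ A →+ Q)
    (halt : ∀ x, B x x = 0) (hnd : ∀ x, (∀ y, B x y = 0) → x = 0)
    (ι : AddSubgroup.torsionBy Q (p : ℤ) →+ ZMod p) (hι : Function.Injective ι)
    (hiso : ∀ x ∈ AddSubgroup.torsionBy A (p : ℤ), ∀ y ∈ AddSubgroup.torsionBy A (p : ℤ),
      B x y = 0) {d : ℕ} (hcard : Nat.card (AddSubgroup.torsionBy A (p : ℤ)) = p ^ d) :
    p ^ (2 * d) ∣ Nat.card A := by
  have h := sq_natCard_torsionBy_dvd_natCard_of_isotropic p B halt hnd ι hι hiso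
  rwa [hcard, ← pow_mul, mul_comm] at h

/-- **The `ℚ/ℤ`-valued, "kernel = divisible elements" form** (the printed Cassels–Tate properties,
Silverman *AEC* X.4.14): for a FINITE abelian group with an alternating pairing `A × A → ℚ/ℤ` whose
kernel is the subgroup of divisible elements (trivial, `A` being finite) and which vanishes on
`A[p] × A[p]`: `#A[p] = p^d ⇒ p^{2d} ∣ #A`. [cite: SilvermanAEC2009, Thm. X.4.14] [cite: Cassels1998, §1] -/
theorem pow_two_mul_dvd_natCard_of_isotropic_addCircle [Finite A]
    (B : A →+ A →+ AddCircle (1 : ℚ)) (halt : ∀ x, B x x = 0)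
    (hker : ∀ x, (∀ y, B x y = 0) ↔ x ∈ AddSubgroup.divisibleElements A)
    (hiso : ∀ x ∈ AddSubgroup.torsionBy A (p : ℤ), ∀ y ∈ AddSubgroup.torsionBy A (p : ℤ),
      B x y = 0) {d : ℕ} (hcard : Nat.card (AddSubgroup.torsionBy A (p : ℤ)) = p ^ d) :
    p ^ (2 * d) ∣ Nat.card A := by
  obtain ⟨ι, hι⟩ := exists_circleTorsion_toZMod_injective p
  have hnd : ∀ x, (∀ y, B x y = 0) → x = 0 := fun x hx => by
    have := (hker x).mp hx
    rwa [divisibleElements_eq_bot_of_finite A, AddSubgroup.mem_bot] at this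
  exact pow_two_mul_dvd_natCard_of_isotropic p B halt hnd ι hι hiso hcard

end Algebra

/-! ### §2 `Ш(E/K)`: `p^{2d} ∣ #Ш` from an isotropic Cassels–Tate pairing on `Ш[p]`, `#Ш[p] = p^d` -/

section Sha

universe u

variable {K : Type u} [Field K] [NumberField K] (W : WeierstrassCurve K) [W.IsElliptic]
  (p : ℕ) [hp : Fact p.Prime]

omit [W.IsElliptic] in
/-- **`p^{2d} ∣ #Ш(E/K)` from an ISOTROPIC Cassels–Tate pairing.** For `E/K` with finite `Ш(E/K)`,
`#Ш(E/K)[p] = p^d`, and a pairing `B : Ш × Ш → ℚ/ℤ` with the printed Cassels–Tate properties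
(alternating, kernel = divisible elements; Silverman X.4.14 / Cassels 1962) which VANISHES on
`Ш[p] × Ш[p]` (the instrument's ZERO Gram matrix): `p^{2d} ∣ #Ш(E/K)`. Certificate-shaped
hypotheses; nothing about any curve is asserted. [cite: SilvermanAEC2009, Thm. X.4.14]
[cite: Cassels1998, §1] [cite: FisherNewton2014, Thm. 1.3] -/
theorem _root_.WeierstrassCurve.pow_two_mul_dvd_card_sha_of_casselsTateIsotropic [Finite W.sha]
    {d : ℕ} (hcard : Nat.card (AddSubgroup.torsionBy W.sha (p : ℤ)) = p ^ d)
    (B : W.sha →+ W.sha →+ AddCircle (1 : ℚ)) (halt : ∀ x, B x x = 0)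
    (hker : ∀ x, (∀ y, B x y = 0) ↔ x ∈ AddSubgroup.divisibleElements W.sha)
    (hiso : ∀ x ∈ AddSubgroup.torsionBy W.sha (p : ℤ), ∀ y ∈ AddSubgroup.torsionBy W.sha (p : ℤ),
      B x y = 0) :
    p ^ (2 * d) ∣ Nat.card W.sha :=
  pow_two_mul_dvd_natCard_of_isotropic_addCircle p B halt hker hiso hcard

/-- **`#Ш(E/K)[p] = #Sel^(p)(E/K)` at rank `0` with `p ∤ #E(K)_tors`** (the descent count
`#Sel^(p) = p^{rank} · #E(K)[p] · #Ш[p]`, Silverman X.4.2, tree `card_selmerGroup_eq_pow_rank_mul`).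
[cite: SilvermanAEC2009, Thm. X.4.2(a)] -/
theorem card_torsionBy_sha_eq_card_selmerGroup_of_rankZero (hrank : W.mordellWeilRank = 0)
    (htors : ¬ p ∣ W.torsionOrder) :
    Nat.card (AddSubgroup.torsionBy W.sha (p : ℤ)) = Nat.card (W.selmerGroup (p : ℤ)) :=
  card_torsionBy_sha_eq_of_card_selmerGroup W p
    (a := 1) (c := Nat.card (W.selmerGroup (p : ℤ)))
    (by rw [hrank, pow_zero, one_mul,
      Supersingular.natCard_torsionBy_eq_one_of_not_dvd_torsionOrder W p htors])
    Nat.one_pos (by rw [one_mul])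

omit [W.IsElliptic] hp in
/-- The element-free isotropy binder unfolds to the membership form. Bookkeeping. [folklore] -/
theorem isotropic_torsionBy_of_forall_nsmul (B : W.sha →+ W.sha →+ AddCircle (1 : ℚ))
    (hiso : ∀ x y : W.sha, p • x = 0 → p • y = 0 → B x y = 0) :
    ∀ x ∈ AddSubgroup.torsionBy W.sha (p : ℤ), ∀ y ∈ AddSubgroup.torsionBy W.sha (p : ℤ),
      B x y = 0 := fun x hx y hy =>
  hiso x y (AddSubgroup.torsionBy.nsmul_iff.mp hx) (AddSubgroup.torsionBy.nsmul_iff.mp hy)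

end Sha

/-! ### §2′ Over `ℚ`: `p^{2d} ∣ #Ш(E/ℚ)` and the typed LOWER half from `#Sel^(p) = p^d` + isotropy -/

section OverQ

variable (W : WeierstrassCurve ℚ) [W.IsElliptic] (p : ℕ) [hp : Fact p.Prime]

/-- **`p^{2d} ∣ #Ш(E/ℚ)` from the `p`-descent count and an isotropic Cassels–Tate pairing.** Rank
`0`, `p ∤ #E(ℚ)_tors`, `#Sel^(p)(E/ℚ) = p^d`, `Ш` finite, and SOME pairing on `Ш(E/ℚ)` with the
printed Cassels–Tate properties vanishing on `Ш[p]` (binder `hCT0`: "the Cassels–Tate pairing is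
zero on `Ш[p] = Sel^(p)`", the ZERO-type CTP document) ⇒ `p^{2d} ∣ #Ш(E/ℚ)`. Per pair.
[cite: SilvermanAEC2009, Thm. X.4.14 and Thm. X.4.2(a)] [cite: Cassels1998, §1] -/
theorem pow_two_mul_dvd_shaOrder_of_casselsTateIsotropic_of_card_selmerGroup
    (hfin : W.ShaFinite) (hrank : W.mordellWeilRank = 0) (htors : ¬ p ∣ W.torsionOrder) {d : ℕ}
    (hSel : Nat.card (W.selmerGroup (p : ℤ)) = p ^ d)
    (hCT0 : ∃ B : W.sha →+ W.sha →+ AddCircle (1 : ℚ), (∀ x, B x x = 0) ∧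
      (∀ x, (∀ y, B x y = 0) ↔ x ∈ AddSubgroup.divisibleElements W.sha) ∧
      ∀ x y : W.sha, p • x = 0 → p • y = 0 → B x y = 0) :
    p ^ (2 * d) ∣ W.shaOrder := by
  haveI : Finite W.sha := hfin
  obtain ⟨B, halt, hker, hiso⟩ := hCT0
  exact W.pow_two_mul_dvd_card_sha_of_casselsTateIsotropic p
    ((card_torsionBy_sha_eq_card_selmerGroup_of_rankZero W p hrank htors).trans hSel) B halt hker
    (isotropic_torsionBy_of_forall_nsmul W p B hiso)

/-- **The typed LOWER half `ord_p #Ш_an ≤ ord_p #Ш` from the isotropic certificate — NO parity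
step.** Analytic rank `0` (`hGZK` ⇒ rank `0`, `Ш` finite), `p ∤ #E(ℚ)_tors`, `#Sel^(p) = p^d`, the
isotropic Cassels–Tate binder, and `ord_p #Ш_an ≤ 2d` ⇒ `MissingLowerBoundAt W p`. Class-free; per
pair. [cite: Miller2011LMS, Def. 1.1] [cite: SilvermanAEC2009, Thm. X.4.14 and Thm. X.4.2(a)] -/
theorem missingLowerBoundAt_of_casselsTateIsotropic_of_card_selmerGroup
    (hGZK : rank_eq_analyticRank_of_analyticRank_le_one) (hr : W.analyticRank = 0)
    (htors : ¬ p ∣ W.torsionOrder) {d : ℕ} (hSel : Nat.card (W.selmerGroup (p : ℤ)) = p ^ d)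
    (hCT0 : ∃ B : W.sha →+ W.sha →+ AddCircle (1 : ℚ), (∀ x, B x x = 0) ∧
      (∀ x, (∀ y, B x y = 0) ↔ x ∈ AddSubgroup.divisibleElements W.sha) ∧
      ∀ x y : W.sha, p • x = 0 → p • y = 0 → B x y = 0)
    {q : ℚ} (hq : shaAn W = (q : ℂ)) (hv : padicValRat p q ≤ 2 * d) :
    MissingLowerBoundAt W p := by
  have hr1 : W.analyticRank ≤ 1 := by rw [hr]; norm_num
  have hrank : W.mordellWeilRank = 0 := by rw [(hGZK W hr1).1, hr]
  have hfin : W.ShaFinite := (hGZK W hr1).2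
  have hdvd := pow_two_mul_dvd_shaOrder_of_casselsTateIsotropic_of_card_selmerGroup W p hfin hrank
    htors hSel hCT0
  have hn : W.shaOrder ≠ 0 := (WeierstrassCurve.shaOrder_pos W hfin).ne'
  have hle : 2 * d ≤ padicValNat p W.shaOrder := (padicValNat_dvd_iff_le hn).mp hdvd
  refine ⟨q, hq, hv.trans ?_⟩
  exact_mod_cast hle

end OverQ

/-! ### §3 (appended, gen 17) Any rank: `#Sel^(p) = p^{rank + d}` + isotropy ⇒ `p^{2d} ∣ #Ш`; rank `≤ 1` lower half -/

section AnyRank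

universe u

variable {K : Type u} [Field K] [NumberField K] (W : WeierstrassCurve K) [W.IsElliptic]
  (p : ℕ) [hp : Fact p.Prime]

/-- **`#Ш(E/K)[p] = p^d` from `#Sel^(p)(E/K) = p^{rank E(K) + d}` and `p ∤ #E(K)_tors`** (the descent
count, Silverman X.4.2, any rank). [cite: SilvermanAEC2009, Thm. X.4.2(a)] -/
theorem card_torsionBy_sha_eq_of_card_selmerGroup_eq_pow_rank_add {r d : ℕ}
    (hrank : W.mordellWeilRank = r) (htors : ¬ p ∣ W.torsionOrder)
    (hSel : Nat.card (W.selmerGroup (p : ℤ)) = p ^ (r + d)) :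
    Nat.card (AddSubgroup.torsionBy W.sha (p : ℤ)) = p ^ d :=
  card_torsionBy_sha_eq_of_card_selmerGroup W p (a := p ^ r) (c := p ^ d)
    (by rw [hrank, Supersingular.natCard_torsionBy_eq_one_of_not_dvd_torsionOrder W p htors, mul_one])
    (pow_pos hp.out.pos _) (by rw [hSel, pow_add])

/-- **Any rank: `p^{2d} ∣ #Ш(E/K)`** from `#Sel^(p)(E/K) = p^{rank + d}`, `p ∤ #E(K)_tors`, finite `Ш`,
and a pairing with the printed Cassels–Tate properties ISOTROPIC on `Ш[p]` (in rank `r ≥ 1` the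
instrument's Gram matrix on `Sel^(p)` has the `r`-dimensional radical `E(K)/pE(K)`; its vanishing on
the whole of `Sel^(p)` is the binder). Per pair. [cite: SilvermanAEC2009, Thm. X.4.14 and Thm. X.4.2(a)]
[cite: Cassels1998, §1] -/
theorem pow_two_mul_dvd_card_sha_of_casselsTateIsotropic_of_card_selmerGroup_eq_pow_rank_add
    [Finite W.sha] {r d : ℕ} (hrank : W.mordellWeilRank = r) (htors : ¬ p ∣ W.torsionOrder)
    (hSel : Nat.card (W.selmerGroup (p : ℤ)) = p ^ (r + d))
    (hCT0 : ∃ B : W.sha →+ W.sha →+ AddCircle (1 : ℚ), (∀ x, B x x = 0) ∧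
      (∀ x, (∀ y, B x y = 0) ↔ x ∈ AddSubgroup.divisibleElements W.sha) ∧
      ∀ x y : W.sha, p • x = 0 → p • y = 0 → B x y = 0) :
    p ^ (2 * d) ∣ Nat.card W.sha := by
  obtain ⟨B, halt, hker, hiso⟩ := hCT0
  exact W.pow_two_mul_dvd_card_sha_of_casselsTateIsotropic p
    (card_torsionBy_sha_eq_of_card_selmerGroup_eq_pow_rank_add W p hrank htors hSel) B halt hker
    (isotropic_torsionBy_of_forall_nsmul W p B hiso)

end AnyRank

section AnyRankOverQ

variable (W : WeierstrassCurve ℚ) [W.IsElliptic] (p : ℕ) [hp : Fact p.Prime]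

/-- **Analytic rank `≤ 1`: the typed LOWER half from `#Sel^(p)(E/ℚ) = p^{r_an + d}` + an isotropic
Cassels–Tate pairing on `Ш[p]` + `ord_p #Ш_an ≤ 2d`** (GZK `hGZK`: `rank = r_an`, `Ш` finite; `p ∤
#E(ℚ)_tors`). The rank-`0` case is `missingLowerBoundAt_of_casselsTateIsotropic_of_card_selmerGroup`;
this is its rank-`≤ 1` twin (e.g. rank-one rows with `81 ∥ #Ш_an` and `dim Sel^(3) = 3`). Class-free;
per pair; NO parity step. [cite: Miller2011LMS, Def. 1.1] [cite: SilvermanAEC2009, Thm. X.4.14 and Thm. X.4.2(a)] -/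
theorem missingLowerBoundAt_of_casselsTateIsotropic_of_card_selmerGroup_of_analyticRank_le_one
    (hGZK : rank_eq_analyticRank_of_analyticRank_le_one) (hr : W.analyticRank ≤ 1)
    (htors : ¬ p ∣ W.torsionOrder) {d : ℕ}
    (hSel : Nat.card (W.selmerGroup (p : ℤ)) = p ^ (W.analyticRank + d))
    (hCT0 : ∃ B : W.sha →+ W.sha →+ AddCircle (1 : ℚ), (∀ x, B x x = 0) ∧
      (∀ x, (∀ y, B x y = 0) ↔ x ∈ AddSubgroup.divisibleElements W.sha) ∧
      ∀ x y : W.sha, p • x = 0 → p • y = 0 → B x y = 0)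
    {q : ℚ} (hq : shaAn W = (q : ℂ)) (hv : padicValRat p q ≤ 2 * d) :
    MissingLowerBoundAt W p := by
  have hrank : W.mordellWeilRank = W.analyticRank := (hGZK W hr).1
  have hfin : W.ShaFinite := (hGZK W hr).2
  haveI : Finite W.sha := hfin
  have hdvd : p ^ (2 * d) ∣ W.shaOrder :=
    pow_two_mul_dvd_card_sha_of_casselsTateIsotropic_of_card_selmerGroup_eq_pow_rank_add W p hrank
      htors hSel hCT0
  have hn : W.shaOrder ≠ 0 := (WeierstrassCurve.shaOrder_pos W hfin).ne'
  have hle : 2 * d ≤ padicValNat p W.shaOrder := (padicValNat_dvd_iff_le hn).mp hdvd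
  refine ⟨q, hq, hv.trans ?_⟩
  exact_mod_cast hle

/-- **Analytic rank `≤ 1`: `BSD(E,p)` from the isotropic certificate when the UPPER half is on file**
(any source: `MissingUpperBoundAt W p` as a hypothesis — e.g. a class theorem, or a Kolyvagin /
Kato bound read per pair). Class-free glue: `missingPPartAt_of_lower_of_upper` + `bsdp_of_missingPPartAt`.
[cite: Miller2011LMS, §1 and Def. 1.1] -/
theorem bsdp_of_upper_of_casselsTateIsotropic_of_card_selmerGroup_of_analyticRank_le_one
    (hGZK : rank_eq_analyticRank_of_analyticRank_le_one) (hr : W.analyticRank ≤ 1)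
    (htors : ¬ p ∣ W.torsionOrder) {d : ℕ}
    (hSel : Nat.card (W.selmerGroup (p : ℤ)) = p ^ (W.analyticRank + d))
    (hCT0 : ∃ B : W.sha →+ W.sha →+ AddCircle (1 : ℚ), (∀ x, B x x = 0) ∧
      (∀ x, (∀ y, B x y = 0) ↔ x ∈ AddSubgroup.divisibleElements W.sha) ∧
      ∀ x y : W.sha, p • x = 0 → p • y = 0 → B x y = 0)
    {q : ℚ} (hq : shaAn W = (q : ℂ)) (hv : padicValRat p q ≤ 2 * d)
    (hup : MissingUpperBoundAt W p) : BSDp W p :=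
  bsdp_of_missingPPartAt W p hGZK hr
    (missingPPartAt_of_lower_of_upper W p
      (missingLowerBoundAt_of_casselsTateIsotropic_of_card_selmerGroup_of_analyticRank_le_one W p hGZK
        hr htors hSel hCT0 hq hv) hup)

end AnyRankOverQ

end Summit.BirchSwinnertonDyer.Rank1Residual.AdditivePotMult

end
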